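import Summits.CriticalPhenomena.PercolationContinuityZ3.Theorems.Transplant.TiltedWedgeComponentClimb
import HarnessLib

/-!
# The full tilted 3D wedge on the component of its base: the EXIT DATUM of a cube (thick exits by the blunted design, thin side exits by the climb)

builds on p205010 (kernel theorem, internal audit signed; external expert review pending) — NOT used in this file.
Lane `prim-bschramm`, seat `prim-bschramm-p2` (gen 27; class C1b, METHOD = input substitution; memo `HOME/bschramm/P2-LATTICES.md` §95);
helper file (`--supports stmt-CriticalPhenomena-4575 --as helper`).

THE USE (sequel `TiltedWedgeComponentUniqueness`): uniqueness of the infinite cluster at every density on the graph `ℤ³[C_β]`,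
`C_β = {x | β ↔ x inside W}` the component of the base of the wedge `W = {s₁x₁ ≤ x₂ ≤ s₂x₁} × ℤ`.  THE DATUM (`exit_datum_comp`, for any
`D ⊆ W` closed under `W`-adjacency, containing the blunted wedge `𝕎_L`, all of whose vertices are joined to `β` inside `W`) = the blunted-wedge design (`TiltedWedgeSlices.exit_datum_core` on `𝕎_L ⊆ C_β`, transferred by monotonicity of the step graph) for the
THICK exits of the cubes, and for the THIN side exits (`u₁ < L`, faces `x₀ = ±N`) a deterministic CLIMB inside the plane `{x₀ = ±(N+1)}` along a
planar path of the sector of length `≤ C*` (`climb_bound`: uniform over the finite set of thin positions; the path exists because `u ∈ C_β`) to the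
thick base point `(±(N+1), L, ⌈s₁L⌉) ∈ 𝕎_L`, followed by the slice and floor data of the blunted wedge.  Probability `≥ α·A.α·A.α⁴`, `≤ 1 + C* + 3k`
extra edges, uniformly in `N ≥ N₀` and in the exit.
[cite: AizenmanChayesChayesFrohlichRusso1983, §4 Thm 4.4, Lemma 4.2 (a), Lemma 4.3] [cite: BarskyGrimmettNewman1991, Cor. to Thm 1.1 (iii), (iv)]
[cite: DuminilCopinSidoraviciusTassion2016, Thm. 1 and §2] [cite: GrimmettPercolation1999, Thm. (7.2)(b) p. 148; §8.3 Thm (8.8) p. 202]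
[cite: ChayesChayes1986Wedges, Thm. 1] -/

noncomputable section

namespace Summit.CriticalPhenomena.PercolationContinuityZ3.Theorems.Transplant

namespace TiltWedgeUniq

open MeasureTheory Literature.Probability.Percolation Literature.Probability.LatticeModels SimpleGraph HSU OrthantUniq HalfSlabUniq
  TubeSlabUniq DesignTransport WallUniq TiltSector Filter
open scoped Classical Topology

variable {s₁ s₂ : ℝ}

/-! ## §1 The exit datum of a cube in a sub-domain containing the blunted wedge -/

section Exit

variable {L : ℕ} {D : Set (Site 3)} (hs : s₁ < s₂) (hs₁ : 0 < s₁) (hs2 : s₁ ≤ 2)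
  (hDW : D ⊆ {x : Site 3 | s₁ * (x 1 : ℝ) ≤ (x 2 : ℝ) ∧ (x 2 : ℝ) ≤ s₂ * (x 1 : ℝ)})
  (hcl : ∀ ⦃a b : Site 3⦄, a ∈ D → b ∈ {x : Site 3 | s₁ * (x 1 : ℝ) ≤ (x 2 : ℝ) ∧ (x 2 : ℝ) ≤ s₂ * (x 1 : ℝ)} → (zdGraph 3).Adj a b → b ∈ D)
  (hLD : {x : Site 3 | (L : ℤ) ≤ x 1 ∧ (s₁ * (x 1 : ℝ) ≤ (x 2 : ℝ) ∧ (x 2 : ℝ) ≤ s₂ * (x 1 : ℝ))} ⊆ D)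
  (hreach : ∀ x ∈ D, (withinGraph (zdGraph 3) {x : Site 3 | s₁ * (x 1 : ℝ) ≤ (x 2 : ℝ) ∧ (x 2 : ℝ) ≤ s₂ * (x 1 : ℝ)}).Reachable
    (![0, (⌈(s₁ + 2) / (s₂ - s₁)⌉₊ : ℤ), ⌈s₁ * (((⌈(s₁ + 2) / (s₂ - s₁)⌉₊ : ℤ) : ℤ) : ℝ)⌉] : Site 3) x)
  {Cst : ℕ} (hclimb : ∀ q : Site 3, q ∈ {x : Site 3 | x ∈ slab 3 0 ∧ (s₁ * (x 1 : ℝ) ≤ (x 2 : ℝ) ∧ (x 2 : ℝ) ≤ s₂ * (x 1 : ℝ))} →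
    q 1 < (L : ℤ) →
    (withinGraph (zdGraph 3) {x : Site 3 | x ∈ slab 3 0 ∧ (s₁ * (x 1 : ℝ) ≤ (x 2 : ℝ) ∧ (x 2 : ℝ) ≤ s₂ * (x 1 : ℝ))}).Reachable
      (![0, (⌈(s₁ + 2) / (s₂ - s₁)⌉₊ : ℤ), ⌈s₁ * (((⌈(s₁ + 2) / (s₂ - s₁)⌉₊ : ℤ) : ℤ) : ℝ)⌉] : Site 3) q →
    ∃ p : (withinGraph (zdGraph 3) {x : Site 3 | x ∈ slab 3 0 ∧ (s₁ * (x 1 : ℝ) ≤ (x 2 : ℝ) ∧ (x 2 : ℝ) ≤ s₂ * (x 1 : ℝ))}).Walk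
      q ![0, (L : ℤ), ⌈s₁ * (((L : ℤ) : ℤ) : ℝ)⌉], p.length ≤ Cst)
  {σ₁ σ₂ : ℝ} (hσ₁ : s₁ ≤ σ₁) (hσ : σ₁ ≤ σ₂) (hσ₂ : σ₂ ≤ s₂)
  {H : ℕ} (hthick : 2 * (H : ℝ) ≤ (s₂ - s₁) * (L : ℝ)) {k N : ℕ} (hLN : (L : ℤ) ≤ (N : ℤ) + 1) (hLNle : L ≤ N) (hsN : s₂ * (L : ℝ) ≤ N)
  {Y Ω₂ Z T : ℤ} (hY : (N : ℤ) + 1 ≤ Y) (hΩ₂ : Ω₂ = ⌈s₁ * (Y : ℝ)⌉) (hZ : Z = ⌊s₂ * (Y : ℝ)⌋) (hΩZ : Ω₂ ≤ Z) (hT : T = Y + (Z - Ω₂))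
  (hfit : (s₂ - σ₂) * (((N : ℤ) + 1 : ℤ) : ℝ) + σ₂ * (T : ℝ) + H + 1 ≤ s₂ * (Y : ℝ))
  {M : ℕ} (hMk : k ≤ M) (hMT : T ≤ (M : ℤ)) (hMs : s₂ * (T : ℝ) ≤ M)
  {p' : unitInterval} (A : SlabArmKit k p') {α : ℝ} (hα : 0 < α)
  (harm : ∀ b : Site 3, b ∈ slab 3 k →
    α ≤ (bondPercolation (zdGraph 3) p').real (percolatesVia (withinGraph (zdGraph 3) (armUpAt k σ₁ σ₂ H b)) b) ∧
    α ≤ (bondPercolation (zdGraph 3) p').real (percolatesVia (withinGraph (zdGraph 3) (armDnAt k σ₁ σ₂ H b)) b))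
  (hN : 1 ≤ N) (hNY : (N : ℤ) + 1 + 2 * ((N + 1 + k : ℕ) : ℤ) ≤ Y) (hfl : (Ω₂ : ℝ) + k ≤ s₂ * ((Y : ℝ) - 2 * ((N + 1 + k : ℕ) : ℝ)))
  {Mt : ℕ} (hM1 : N + 1 ≤ Mt) (hM2 : M + (N + 1 + k) ≤ Mt) (hM3 : k + 2 + 6 * (N + 1 + k) + ((Y + 1).natAbs + Ω₂.natAbs) ≤ Mt)
  (hM4 : N + 1 + Cst ≤ Mt)

include hs hs₁ hs2 hDW hcl hLD hreach hclimb hσ₁ hσ hσ₂ hthick hLN hLNle hsN hY hΩ₂ hZ hΩZ hT hfit hMk hMT hMs hα harm hN hNY hfl hM1 hM2 hM3 hM4 in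
/-- **THE EXIT DATUM OF THE CUBE `[-N,N]³` IN A SUB-DOMAIN `D` OF THE WEDGE CONTAINING `𝕎_L`** (`D ⊆ W` closed under `W`-adjacency, every vertex
of `D` joined to the base inside `W`; all size constraints explicit): every `u ∈ [-N,N]³` with a `D`-neighbour outside the cube is joined to the
station `(0, Y, Ω₂)` through open exterior steps of the cube inside `D` by `≤ 1 + C* + 3k` extra open edges of `[-M*, M*]³` on an increasing event of
probability `≥ α·A.α·A.α⁴` — thick exits by the blunted-wedge design (`exit_datum_core` in `𝕎_L ⊆ D`), thin side exits by escape + CLIMB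
(`lifted_walk_datum`, `climb_bound`) + slice + floor. [cite: AizenmanChayesChayesFrohlichRusso1983, §4 Cor. to Lemma 4.3 and Lemma 4.2 (a)] -/
theorem exit_datum_comp {u : Site 3} (hu : u ∈ boxSet 3 N) (hw : ∃ w, w ∉ boxSet 3 N ∧ (withinGraph (zdGraph 3) D).Adj u w) :
    ∃ E : Set (BondConfig (Site 3)), IsUpperSet E ∧ MeasurableSet E ∧ DeterminedBy E ↑(edgesIn (zdGraph 3) (box 3 Mt)) ∧
      α * A.α * (A.α ^ 2 * A.α ^ 2) ≤ (bondPercolation (zdGraph 3) p').real E ∧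
      ∀ ω ∈ E, ∃ F : Finset (Sym2 (Site 3)), F ⊆ edgesIn (zdGraph 3) (box 3 Mt) ∧ F.card ≤ 1 + (Cst + (k + (k + k))) ∧
        ω ∪ ↑F ∈ openConnVia (starGraph (withinGraph (zdGraph 3) D) Set.univ (boxSet 3 N)) u ![0, Y, Ω₂] := by
  have hs₂ : 0 < s₂ := hs₁.trans hs
  have hWL : ∀ x : Site 3, x ∈ {x : Site 3 | (L : ℤ) ≤ x 1 ∧ (s₁ * (x 1 : ℝ) ≤ (x 2 : ℝ) ∧ (x 2 : ℝ) ≤ s₂ * (x 1 : ℝ))} ↔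
      ((L : ℤ) ≤ x 1 ∧ (s₁ * (x 1 : ℝ) ≤ (x 2 : ℝ) ∧ (x 2 : ℝ) ≤ s₂ * (x 1 : ℝ))) := fun x => Iff.rfl
  obtain ⟨huD, hcases⟩ := sub_exit_cases hs hs₁ hDW hN hu hw
  have huW := hDW huD
  have hub := mem_boxSet_iff.1 hu
  -- the graph monotonicity `𝕎_L ⊆ D`
  have hK : starGraph (withinGraph (zdGraph 3) {x : Site 3 | (L : ℤ) ≤ x 1 ∧ (s₁ * (x 1 : ℝ) ≤ (x 2 : ℝ) ∧ (x 2 : ℝ) ≤ s₂ * (x 1 : ℝ))})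
      Set.univ (boxSet 3 N) ≤ starGraph (withinGraph (zdGraph 3) D) Set.univ (boxSet 3 N) :=
    fun a b hab => ⟨withinGraph_mono (zdGraph 3) hLD hab.1, hab.2.1, hab.2.2.1, hab.2.2.2⟩
  -- THICK exits: `u ∈ 𝕎_L` with a `𝕎_L`-neighbour outside the cube
  have thick : ∀ (w : Site 3), w ∈ D → w ∉ boxSet 3 N → (zdGraph 3).Adj u w → (L : ℤ) ≤ u 1 → (L : ℤ) ≤ w 1 →
      ∃ E : Set (BondConfig (Site 3)), IsUpperSet E ∧ MeasurableSet E ∧ DeterminedBy E ↑(edgesIn (zdGraph 3) (box 3 Mt)) ∧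
        α * A.α * (A.α ^ 2 * A.α ^ 2) ≤ (bondPercolation (zdGraph 3) p').real E ∧
        ∀ ω ∈ E, ∃ F : Finset (Sym2 (Site 3)), F ⊆ edgesIn (zdGraph 3) (box 3 Mt) ∧ F.card ≤ 1 + (Cst + (k + (k + k))) ∧
          ω ∪ ↑F ∈ openConnVia (starGraph (withinGraph (zdGraph 3) D) Set.univ (boxSet 3 N)) u ![0, Y, Ω₂] := by
    intro w hwD hwbox hadj hu1 hw1
    have huL : u ∈ {x : Site 3 | (L : ℤ) ≤ x 1 ∧ (s₁ * (x 1 : ℝ) ≤ (x 2 : ℝ) ∧ (x 2 : ℝ) ≤ s₂ * (x 1 : ℝ))} := ⟨hu1, huW⟩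
    have hwL : w ∈ {x : Site 3 | (L : ℤ) ≤ x 1 ∧ (s₁ * (x 1 : ℝ) ≤ (x 2 : ℝ) ∧ (x 2 : ℝ) ≤ s₂ * (x 1 : ℝ))} := ⟨hw1, hDW hwD⟩
    have h := exit_datum_core hWL hs hs₁ hs2 hσ₁ hσ hσ₂ hthick hLN hY hΩ₂ hZ hΩZ hT hfit hMk hMT hMs A hα harm hN hNY hfl hM1 hM2 hM3 hu
      ⟨w, hwbox, withinGraph_adj.2 ⟨hadj, huL, hwL⟩⟩
    exact design_weaken (one_mul _).ge (by omega) (design_mono_graph hK h)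
  by_cases hu1 : (L : ℤ) ≤ u 1
  · -- every exit type is thick
    rcases hcases with ⟨hu1N, hbD⟩ | ⟨hu2N, hbD⟩ | ⟨hu0N, hbD⟩ | ⟨hu0N, hbD⟩
    · have e1 : (u + Pi.single 1 1 : Site 3) 1 = u 1 + 1 := by simp
      exact thick _ hbD (fun h => by have := (mem_boxSet_iff.1 h) 1; rw [e1] at this; omega)
        ((zdGraph_adj_iff _ _).2 ⟨1, Or.inl rfl⟩) hu1 (by rw [e1]; omega)
    · have e1 : (u + Pi.single 2 1 : Site 3) 1 = u 1 := by simp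
      have e2 : (u + Pi.single 2 1 : Site 3) 2 = u 2 + 1 := by simp
      exact thick _ hbD (fun h => by have := (mem_boxSet_iff.1 h) 2; rw [e2] at this; omega)
        ((zdGraph_adj_iff _ _).2 ⟨2, Or.inl rfl⟩) hu1 (by rw [e1]; exact hu1)
    · have e1 : (u + Pi.single 0 1 : Site 3) 1 = u 1 := by simp
      have e0 : (u + Pi.single 0 1 : Site 3) 0 = u 0 + 1 := by simp
      exact thick _ hbD (fun h => by have := (mem_boxSet_iff.1 h) 0; rw [e0] at this; omega)
        ((zdGraph_adj_iff _ _).2 ⟨0, Or.inl rfl⟩) hu1 (by rw [e1]; exact hu1)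
    · have e1 : (u - Pi.single 0 1 : Site 3) 1 = u 1 := by simp
      have e0 : (u - Pi.single 0 1 : Site 3) 0 = u 0 - 1 := by simp
      exact thick _ hbD (fun h => by have := (mem_boxSet_iff.1 h) 0; rw [e0] at this; omega)
        ((zdGraph_adj_iff _ _).2 ⟨0, Or.inr (by simp)⟩) hu1 (by rw [e1]; exact hu1)
  · -- THIN exits: only the side faces (top: `u₁ = N ≥ L`; right: `u₂ = N`, `s₂u₁ ≥ N ≥ s₂L`)
    push Not at hu1
    have hLr : (u 1 : ℝ) < (L : ℝ) := by exact_mod_cast hu1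
    rcases hcases with ⟨hu1N, -⟩ | ⟨hu2N, -⟩ | hside
    · exfalso; omega
    · exfalso
      have h2 := huW.2
      rw [hu2N] at h2
      push_cast at h2
      have : s₂ * (u 1 : ℝ) < s₂ * (L : ℝ) := mul_lt_mul_of_pos_left hLr hs₂
      linarith
    -- the side apex `b = u ± e₀`, its plane `x₀ = c₀`, and the slice base `c`
    obtain ⟨c₀, c, b, hbD, hadj, hb0, hb1, hb2, hc, hck, hcabs, hcoff⟩ : ∃ (c₀ c : ℤ) (b : Site 3), b ∈ D ∧ (zdGraph 3).Adj u b ∧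
        b 0 = c₀ ∧ b 1 = u 1 ∧ b 2 = u 2 ∧ c ≤ c₀ ∧ c₀ ≤ c + k ∧ |c| ≤ ((N + 1 + k : ℕ) : ℤ) ∧
        (∀ x : Site 3, c ≤ x 0 → x 0 ≤ c + k → x ∉ boxSet 3 N) ∧ (c₀ = (N : ℤ) + 1 ∨ c₀ = -(N : ℤ) - 1) := by
      rcases hside with ⟨hu0N, hbD⟩ | ⟨hu0N, hbD⟩
      · refine ⟨(N : ℤ) + 1, (N : ℤ) + 1, u + Pi.single 0 1, hbD, (zdGraph_adj_iff _ _).2 ⟨0, Or.inl rfl⟩, by simp [hu0N], by simp,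
          by simp, le_rfl, by omega, by rw [abs_le]; push_cast; constructor <;> omega, fun x h0 _ hxb => ?_, Or.inl rfl⟩
        have := (mem_boxSet_iff.1 hxb) 0; omega
      · refine ⟨-(N : ℤ) - 1, -(N : ℤ) - 1 - k, u - Pi.single 0 1, hbD, (zdGraph_adj_iff _ _).2 ⟨0, Or.inr (by simp)⟩,
          by rw [Pi.sub_apply, Pi.single_eq_same, hu0N], by simp, by simp, by omega, by omega, by rw [abs_le]; push_cast; constructor <;> omega,
          fun x _ h0 hxb => ?_, Or.inr rfl⟩
        have := (mem_boxSet_iff.1 hxb) 0; omega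
    obtain ⟨hcoff', hc₀⟩ := hcoff
    have hc₀abs : |c₀| = (N : ℤ) + 1 := by rcases hc₀ with rfl | rfl <;> rw [abs_eq (by positivity)] <;> [left; right] <;> ring
    have hbW := hDW hbD
    have hbbox : b ∉ boxSet 3 N := hcoff' b (by rw [hb0]; exact hc) (by rw [hb0]; exact hck)
    -- (i) the escape step
    have hbM : ∀ j, |b j| ≤ (Mt : ℤ) := by
      intro j; fin_cases j
      · show |b 0| ≤ (Mt : ℤ); rw [hb0, hc₀abs]; omega
      · show |b 1| ≤ (Mt : ℤ); rw [hb1]; have := hub 1; rw [abs_le]; omega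
      · show |b 2| ≤ (Mt : ℤ); rw [hb2]; have := hub 2; rw [abs_le]; omega
    have huM : ∀ j, |u j| ≤ (Mt : ℤ) := fun j => by have := hub j; rw [abs_le]; omega
    have h₁ := step_datum (D := D) (Λ := boxSet 3 N) p' hadj huD hbD (fun h => hbbox h.2) huM hbM
    -- (ii) the climb inside the plane `x₀ = c₀`
    set q : Site 3 := ![0, u 1, u 2] with hq
    have hqT : q ∈ {x : Site 3 | x ∈ slab 3 0 ∧ (s₁ * (x 1 : ℝ) ≤ (x 2 : ℝ) ∧ (x 2 : ℝ) ≤ s₂ * (x 1 : ℝ))} := proj_mem huW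
    have hqreach : (withinGraph (zdGraph 3) {x : Site 3 | x ∈ slab 3 0 ∧ (s₁ * (x 1 : ℝ) ≤ (x 2 : ℝ) ∧ (x 2 : ℝ) ≤ s₂ * (x 1 : ℝ))}).Reachable
        (![0, (⌈(s₁ + 2) / (s₂ - s₁)⌉₊ : ℤ), ⌈s₁ * (((⌈(s₁ + 2) / (s₂ - s₁)⌉₊ : ℤ) : ℤ) : ℝ)⌉] : Site 3) q := by
      obtain ⟨pw⟩ := hreach u huD
      have h := proj_reachable pw
      have e : (![0, (![0, (⌈(s₁ + 2) / (s₂ - s₁)⌉₊ : ℤ), ⌈s₁ * (((⌈(s₁ + 2) / (s₂ - s₁)⌉₊ : ℤ) : ℤ) : ℝ)⌉] : Site 3) 1,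
          (![0, (⌈(s₁ + 2) / (s₂ - s₁)⌉₊ : ℤ), ⌈s₁ * (((⌈(s₁ + 2) / (s₂ - s₁)⌉₊ : ℤ) : ℤ) : ℝ)⌉] : Site 3) 2] : Site 3) =
          ![0, (⌈(s₁ + 2) / (s₂ - s₁)⌉₊ : ℤ), ⌈s₁ * (((⌈(s₁ + 2) / (s₂ - s₁)⌉₊ : ℤ) : ℤ) : ℝ)⌉] := by
        ext l; fin_cases l <;> simp
      rw [e] at h
      exact h
    obtain ⟨pc, hpc⟩ := hclimb q hqT (by simp [hq]; exact hu1) hqreach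
    have hstart : q + ![c₀, 0, 0] = b := by
      ext l; fin_cases l
      · simp [hq, hb0]
      · simp [hq, hb1]
      · simp [hq, hb2]
    have hsupp0 : ∀ z ∈ pc.support, z 0 = 0 := fun z hz => by
      have h0 := (support_subset_of_walk_withinGraph (zdGraph 3) pc hqT z hz).1
      have : z 0 ≤ 0 ∧ 0 ≤ z 0 := ⟨by simpa using h0.2, h0.1⟩
      omega
    have h₂ := lifted_walk_datum (Λ := boxSet 3 N) hcl c₀ (M := Mt) p' pc (by rw [hstart]; exact hbD)
      (fun z hz hzb => by
        have h0 := (mem_boxSet_iff.1 hzb) 0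
        rw [(HornUniq.add_vec_apply z c₀).1, hsupp0 z hz] at h0
        rcases hc₀ with rfl | rfl <;> omega)
      (fun z hz j => by
        have hzq := walk_coord_bound pc z hz
        obtain ⟨e0, e1, e2⟩ := HornUniq.add_vec_apply z c₀
        have hlen : (pc.length : ℤ) ≤ Cst := by exact_mod_cast hpc
        fin_cases j
        · show |(z + ![c₀, 0, 0]) 0| ≤ (Mt : ℤ); rw [e0, hsupp0 z hz, zero_add, hc₀abs]; omega
        · show |(z + ![c₀, 0, 0]) 1| ≤ (Mt : ℤ); rw [e1]
          have h1 := hzq 1; have hu1b := hub 1; simp [hq] at h1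
          rw [abs_le] at h1 ⊢; omega
        · show |(z + ![c₀, 0, 0]) 2| ≤ (Mt : ℤ); rw [e2]
          have h1 := hzq 2; have hu2b := hub 2; simp [hq] at h1
          rw [abs_le] at h1 ⊢; omega)
    rw [hstart] at h₂
    -- the thick base point `t = (c₀, L, ⌈s₁L⌉) ∈ 𝕎_L` (the endpoint of the climb lies in the sector slice)
    have hend := support_subset_of_walk_withinGraph (zdGraph 3) pc hqT _ pc.end_mem_support
    obtain ⟨f0, f1, f2⟩ := HornUniq.add_vec_apply (![0, (L : ℤ), ⌈s₁ * (((L : ℤ) : ℤ) : ℝ)⌉] : Site 3) c₀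
    have ht0 : ((![0, (L : ℤ), ⌈s₁ * (((L : ℤ) : ℤ) : ℝ)⌉] : Site 3) + ![c₀, 0, 0]) 0 = c₀ := by rw [f0]; simp
    have ht1 : ((![0, (L : ℤ), ⌈s₁ * (((L : ℤ) : ℤ) : ℝ)⌉] : Site 3) + ![c₀, 0, 0]) 1 = L := by rw [f1]; simp
    have htL : (![0, (L : ℤ), ⌈s₁ * (((L : ℤ) : ℤ) : ℝ)⌉] : Site 3) + ![c₀, 0, 0] ∈
        {x : Site 3 | (L : ℤ) ≤ x 1 ∧ (s₁ * (x 1 : ℝ) ≤ (x 2 : ℝ) ∧ (x 2 : ℝ) ≤ s₂ * (x 1 : ℝ))} := by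
      refine ⟨by rw [ht1], ?_, ?_⟩
      · rw [f1, f2]; exact hend.2.1
      · rw [f1, f2]; exact hend.2.2
    -- (iii) the slice datum from `t` and (iv) the floor datum, in `𝕎_L`, transferred to `D`
    have hcn : c.natAbs ≤ N + 1 + k := by
      have h := hcabs; rw [← Int.natCast_natAbs] at h; exact_mod_cast h
    have hΩ₂lo : s₁ * (Y : ℝ) ≤ (Ω₂ : ℝ) := by rw [hΩ₂]; exact Int.le_ceil _
    have h₃ := design_mono (subset_refl _) (show M + (c.natAbs + 0 + 0) ≤ Mt by omega)
      (slice_far_datum hWL hs hs₁ hs2 hσ₁ hσ hσ₂ hthick hLN hY hΩ₂ hZ hΩZ hT hfit hMk hMT hMs A hα harm htL (by rw [ht0]; exact hc)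
        (by rw [ht0]; exact hck) (by rw [ht1]; exact hLN) (fun x _ hx0 hx0' _ => hcoff' x hx0 hx0'))
    have h₄ := design_mono (subset_refl _) hM3 (floor_datum hWL hs hs₁ (Lh := N + 1 + k) hΩ₂lo hLN hNY hfl A hcabs)
    have h₃₄ := design_mono_graph hK (design_chain (mul_pos hα A.α_pos).le h₃ h₄)
    have h₂' := design_weaken le_rfl hpc h₂
    have h₂₃₄ := design_chain zero_le_one h₂' h₃₄
    have hall := design_chain zero_le_one h₁ h₂₃₄
    exact design_weaken (le_of_eq (by ring)) le_rfl hall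

end Exit

end TiltWedgeUniq

end Summit.CriticalPhenomena.PercolationContinuityZ3.Theorems.Transplant

end
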